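import Literature.IUT.LogVolume.RArithmeticDivisors
import Mathlib.NumberTheory.Height.NumberField
import Mathlib.RingTheory.DedekindDomain.FiniteAdeleRing
import HarnessLib

/-!
# [GenEll] §1 p. 5 / Definition 1.2 (i) for `(ℙ¹_ℤ, 𝒪(1))`: the height of a point as the degree of
# an arithmetic divisor — Mathlib's Weil height `logHeight₁` IS `deg_F(x_F^* 𝒪̄(1))`

S. Mochizuki, *Arithmetic elliptic curves in general position*, Math. J. Okayama Univ. **52** (2010),
§1, journal p. 5, read on the page (corpus `paper:doi-10-18926-mjou-33503` p. 5): "… for any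
`x ∈ X(Q̄) = ⋃_{Q̄ ⊇ F, [F:ℚ] < ∞} X(F)` and any arithmetic line bundle `M̄` on `X`, it makes sense to
define `ht_M̄(x) := deg_F(x_F^* M̄) ∈ ℝ` — where `x_F : Spec(O_F) → X` is any morphism that gives rise
to `x`. Definition 1.2. (i) We shall refer to the function `ht_M̄ : X(Q̄) → ℝ` as the height function
associated to the arithmetic line bundle `M̄`." (`deg_F` normalised: p. 5 "if we set
`deg_F := (1/[F:ℚ])·deg_F`"; Prop. 1.4 (iii) p. 6: the BD-class of `ht_L̄` depends only on `L_ℚ`.)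

The downstream chain uses exactly one instance: `X = ℙ¹_ℤ`, `M̄ = 𝒪̄(1)` ([IUTchIV] Cor. 2.2, [GenEll]
Thm. 2.1 (ii)); the tree's `GenEllProjLine` TAKES `ht(x) := (1/[F:ℚ])·logHeight₁ x` (Mathlib's Weil
height) as the representative, recording in prose that this is `deg_F(x_F^* 𝒪̄(1))`. This file makes
that sentence a THEOREM at the level of arithmetic divisors ([IUTchIV] Def. 1.9 `ADivisor`,
`RArithmeticDivisors`):

* `ADivisor.heightDivisor x` — the effective arithmetic divisor `x_F^*(𝒪̄(1), s = X₁)` of the point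
  `(x : 1) ∈ ℙ¹(F)` for the section `X₁` (vanishing at `∞`) and the sup-metric
  `‖X₁‖(x₀:x₁) = |x₁|/max(|x₀|,|x₁|)`: finite part `Σ_v max(0, −ord_v(x))·v` (the divisor of poles of
  `x`), archimedean part `Σ_{v|∞} [F_v:ℝ]·log⁺|x|_v·v`;
* **`degF_heightDivisor : deg_F(heightDivisor x) = logHeight₁ x`** (Mathlib `NumberField.logHeight₁_eq`
  + `log⁺‖x‖_v = max(0,−ord_v x)·log q_v`), `ndeg_heightDivisor` (the normalised form = `NFPoint.ht`);
* (in `GenEllConductorBoundedByHeight`, which also imports the principal divisors:)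
  `heightDivisor x − heightDivisor x⁻¹ = −ADiv(x)` — computing with the other section `X₀` changes the
  divisor by a PRINCIPAL divisor, so the degree is independent of the section (product formula);
* the Fubini–Study metric ([GenEll] p. 8, proof of Prop. 1.4 (iv): "`L_P` … the line bundle `O_P(1)`
  equipped with the standard Fubini-Study metric") instead of the sup-metric (`heightDivisorFS`,
  archimedean part `[F_v:ℝ]·½·log(1+|x|_v²)`) changes `deg_F` by at most `[F:ℚ]·(log 2)/2`
  (`abs_degF_heightDivisorFS_sub_le`), i.e. the normalised heights by at most `(log 2)/2` uniformly in
  `F` — the instance of Prop. 1.4 (iii) ("the BD-class of `ht_L̄` depends only on `L_ℚ`") for two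
  metrics on `𝒪(1)`.
`TODO(general form)`: arithmetic line bundles on a general arithmetic variety `X` (Def. 1.1) are not
typed (cf. `GenEllProjLine`). Classical; no statement of the disputed corpus is involved.
[cite: MochizukiGenEll2010, §1 p.5, Def. 1.2 (i)]
-/

noncomputable section

namespace Literature.IUT.LogVolume

open NumberField IsDedekindDomain Finset Real

variable (F : Type*) [Field F] [NumberField F]

/-- `log⁺‖x‖_v = max(0, −ord_v(x))·log(q_v)` at a finite place (`‖x‖_v = q_v^{−ord_v(x)}`; for `x = 0`
both sides vanish). [cite: MochizukiGenEll2010, §1 p.5] -/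
theorem posLog_adicAbv_eq (v : HeightOneSpectrum (𝓞 F)) (x : F) :
    log⁺ (NumberField.HeightOneSpectrum.adicAbv F v x) = ((-ord F v x).toNat : ℝ) * logNorm F v := by
  by_cases hx : x = 0
  · simp [hx, ord_zero]
  have hN : (1 : ℝ) < (Ideal.absNorm v.asIdeal : ℝ) := by
    exact_mod_cast NumberField.HeightOneSpectrum.one_lt_absNorm v
  have hN0 : (0 : ℝ) < (Ideal.absNorm v.asIdeal : ℝ) := zero_lt_one.trans hN
  rw [adicAbv_eq_absNorm_zpow F v hx, logNorm]
  set n : ℤ := -ord F v x with hn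
  rcases le_or_gt 0 n with h | h
  · have h1 : (1 : ℝ) ≤ (Ideal.absNorm v.asIdeal : ℝ) ^ n := one_le_zpow₀ hN.le h
    have habs : (1 : ℝ) ≤ |(Ideal.absNorm v.asIdeal : ℝ) ^ n| := by rwa [abs_of_pos (zpow_pos hN0 _)]
    rw [posLog_eq_log habs, Real.log_zpow]
    congr 1
    exact_mod_cast (Int.toNat_of_nonneg h).symm
  · have h1 : (Ideal.absNorm v.asIdeal : ℝ) ^ n ≤ 1 := zpow_le_one_of_nonpos₀ hN.le h.le
    have habs : |(Ideal.absNorm v.asIdeal : ℝ) ^ n| ≤ 1 := by rwa [abs_of_pos (zpow_pos hN0 _)]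
    rw [(posLog_eq_zero_iff _).mpr habs, Int.toNat_eq_zero.mpr h.le]
    simp

/-- `ord_v(x) > 0 ↔ |x|_v < 1` (`x ≠ 0`). [cite: MochizukiGenEll2010, Def. 1.5 (iv) p.9] -/
theorem ord_pos_iff_valuation_lt_one (v : HeightOneSpectrum (𝓞 F)) {x : F} (hx : x ≠ 0) :
    0 < ord F v x ↔ v.valuation F x < 1 := by
  have hvx : v.valuation F x ≠ 0 := (v.valuation F).ne_zero_iff.mpr hx
  rw [ord, neg_pos, ← WithZero.log_one, WithZero.log_lt_log hvx one_ne_zero]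

/-- `ord_v(x) < 0 ↔ 1 < |x|_v` (`x ≠ 0`): the poles of `x` form Mathlib's (finite)
`HeightOneSpectrum.Support`. [cite: MochizukiGenEll2010, Def. 1.5 (iv) p.9] -/
theorem ord_neg_iff_one_lt_valuation (v : HeightOneSpectrum (𝓞 F)) {x : F} (hx : x ≠ 0) :
    ord F v x < 0 ↔ 1 < v.valuation F x := by
  have hvx : v.valuation F x ≠ 0 := (v.valuation F).ne_zero_iff.mpr hx
  rw [ord, neg_lt_zero, ← WithZero.log_one, WithZero.log_lt_log one_ne_zero hvx]

/-- Only finitely many `v` have `ord_v(x) < 0` (Mathlib `HeightOneSpectrum.Support.finite`; empty for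
`x = 0` by the junk convention). [cite: MochizukiGenEll2010, §1 p.5] -/
theorem finite_setOf_ord_neg (x : F) : {v : HeightOneSpectrum (𝓞 F) | ord F v x < 0}.Finite := by
  by_cases hx : x = 0
  · simp [hx, ord_zero]
  · have h := HeightOneSpectrum.Support.finite (𝓞 F) x
    refine h.subset fun v hv => ?_
    exact (ord_neg_iff_one_lt_valuation F v hx).mp hv

namespace ADivisor

variable {F}

/-- Archimedean part of `x_F^*𝒪̄(1)` (sup-metric): `v ↦ [F_v:ℝ]·log⁺|x|_v`.
[cite: MochizukiGenEll2010, §1 p.5] -/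
def heightArc (x : F) : InfinitePlace F →₀ ℝ :=
  Finsupp.equivFunOnFinite.symm fun w => (w.mult : ℝ) * log⁺ (w x)

/-- Nonarchimedean part of `x_F^*𝒪̄(1)`: the divisor of poles `v ↦ max(0, −ord_v(x))`.
[cite: MochizukiGenEll2010, §1 p.5] -/
def heightNon (x : F) : HeightOneSpectrum (𝓞 F) →₀ ℝ :=
  Finsupp.ofSupportFinite (fun v => ((-ord F v x).toNat : ℝ))
    ((finite_setOf_ord_neg F x).subset fun v hv => by
      simp only [Function.mem_support, ne_eq, Nat.cast_eq_zero, Int.toNat_eq_zero, not_le] at hv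
      simp only [Set.mem_setOf_eq]
      omega)

/-- **`heightDivisor x = x_F^*(𝒪̄(1), X₁)`**: the effective arithmetic divisor of the point `(x:1) ∈ ℙ¹(F)`
(poles of `x` at the finite places, `[F_v:ℝ]·log⁺|x|_v` at the archimedean ones).
[cite: MochizukiGenEll2010, §1 p.5, Def. 1.2 (i)] -/
def heightDivisor (x : F) : ADivisor F := (heightArc x).sumElim (heightNon x)

/-- Archimedean coefficients. [cite: MochizukiGenEll2010, §1 p.5] -/
@[simp] theorem heightDivisor_apply_inl (x : F) (w : InfinitePlace F) :
    heightDivisor x (Sum.inl w) = (w.mult : ℝ) * log⁺ (w x) := rfl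

/-- Nonarchimedean coefficients: `max(0, −ord_v(x)) ∈ ℕ`. [cite: MochizukiGenEll2010, §1 p.5] -/
@[simp] theorem heightDivisor_apply_inr (x : F) (v : HeightOneSpectrum (𝓞 F)) :
    heightDivisor x (Sum.inr v) = ((-ord F v x).toNat : ℝ) := rfl

/-- `x_F^*𝒪̄(1)` is effective. [cite: MochizukiGenEll2010, §1 p.5] -/
theorem heightDivisor_isEffective (x : F) : (heightDivisor x).IsEffective := by
  rintro (w | v)
  · exact mul_nonneg (Nat.cast_nonneg _) posLog_nonneg
  · exact Nat.cast_nonneg _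

/-- `heightDivisor 0 = 0` and `heightDivisor 1 = 0`. [cite: MochizukiGenEll2010, §1 p.5] -/
@[simp] theorem heightDivisor_zero : heightDivisor (0 : F) = 0 := by
  ext (w | v) <;> simp [ord_zero]

/-- `heightDivisor 1 = 0`. [cite: MochizukiGenEll2010, §1 p.5] -/
@[simp] theorem heightDivisor_one : heightDivisor (1 : F) = 0 := by
  ext (w | v) <;> simp [ord_one]

end ADivisor

/-! ### The degree of `x_F^*𝒪̄(1)` is the Weil height -/

/-- **`deg_F(x_F^* 𝒪̄(1)) = logHeight₁ x`** — [GenEll] Def. 1.2 (i) `ht_M̄(x) := deg_F(x_F^* M̄)` for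
`(ℙ¹_ℤ, 𝒪̄(1))` is Mathlib's logarithmic Weil height on the number field `F`.
[cite: MochizukiGenEll2010, §1 p.5, Def. 1.2 (i)] -/
theorem degF_heightDivisor (x : F) : degF F (ADivisor.heightDivisor x) = Height.logHeight₁ x := by
  rw [NumberField.logHeight₁_eq, degF_apply, ADivisor.heightDivisor, Finsupp.sum_sumElim]
  -- archimedean part
  have harc : (ADivisor.heightArc x).sum (fun w c => c * degWeight F (Sum.inl w)) =
      ∑ w : InfinitePlace F, (w.mult : ℝ) * log⁺ (w x) := by
    rw [Finsupp.sum_fintype _ _ (fun _ => by simp)]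
    simp [ADivisor.heightArc]
  -- nonarchimedean part: the finsum over Mathlib's finite places is a finite sum over maximal ideals
  have hfin : ∑ᶠ w : FinitePlace F, log⁺ (w x) =
      ∑ᶠ v : HeightOneSpectrum (𝓞 F), log⁺ (NumberField.HeightOneSpectrum.adicAbv F v x) := by
    rw [← finsum_comp_equiv FinitePlace.equivHeightOneSpectrum.symm]
    simp only [FinitePlace.equivHeightOneSpectrum_symm_apply, FinitePlace.norm_embedding]
  have hsupp : (Function.support fun v : HeightOneSpectrum (𝓞 F) =>
      log⁺ (NumberField.HeightOneSpectrum.adicAbv F v x)) ⊆ ((ADivisor.heightNon x).support : Set _) := by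
    intro v hv
    rw [Function.mem_support, posLog_adicAbv_eq] at hv
    simp only [Finset.mem_coe, Finsupp.mem_support_iff, ADivisor.heightNon, Finsupp.ofSupportFinite_coe]
    exact fun h => hv (by rw [h, zero_mul])
  have hnon : (ADivisor.heightNon x).sum (fun v c => c * degWeight F (Sum.inr v)) =
      ∑ᶠ w : FinitePlace F, log⁺ (w x) := by
    rw [hfin, finsum_eq_sum_of_support_subset _ hsupp, Finsupp.sum]
    refine Finset.sum_congr rfl fun v _ => ?_
    simp [ADivisor.heightNon, Finsupp.ofSupportFinite_coe, posLog_adicAbv_eq]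
  change (ADivisor.heightArc x).sum (fun w c => c * degWeight F (Sum.inl w)) +
    (ADivisor.heightNon x).sum (fun v c => c * degWeight F (Sum.inr v)) = _
  rw [harc, hnon]

/-- Normalised form: `deg(x_F^*𝒪̄(1)) = logHeight₁ x / [F:ℚ]` (= `NFPoint.ht` of `GenEllProjLine`).
[cite: MochizukiGenEll2010, §1 p.5, Def. 1.2 (i)] -/
theorem ndeg_heightDivisor (x : F) :
    ndeg F (ADivisor.heightDivisor x) = Height.logHeight₁ x / Module.finrank ℚ F := by
  rw [ndeg_apply, degF_heightDivisor]

/-! ### Another metric on `𝒪(1)`: Fubini–Study vs sup (an instance of Prop. 1.4 (iii)) -/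

namespace ADivisor

variable {F}

/-- `x_F^*(𝒪̄(1)_{FS}, X₁)`: the same divisor of poles, archimedean part `[F_v:ℝ]·½·log(1+|x|_v²)`
(Fubini–Study metric `‖X₁‖(x₀:x₁) = |x₁|/√(|x₀|²+|x₁|²)`). [cite: MochizukiGenEll2010, §1 p.5, Prop. 1.4 (iii)] -/
def heightDivisorFS (x : F) : ADivisor F :=
  (Finsupp.equivFunOnFinite.symm fun w : InfinitePlace F =>
      (w.mult : ℝ) * (2⁻¹ * Real.log (1 + (w x) ^ 2))).sumElim (heightNon x)

/-- Archimedean coefficients of the FS divisor. [cite: MochizukiGenEll2010, §1 p.5] -/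
@[simp] theorem heightDivisorFS_apply_inl (x : F) (w : InfinitePlace F) :
    heightDivisorFS x (Sum.inl w) = (w.mult : ℝ) * (2⁻¹ * Real.log (1 + (w x) ^ 2)) := rfl

/-- Nonarchimedean coefficients of the FS divisor (same poles). [cite: MochizukiGenEll2010, §1 p.5] -/
@[simp] theorem heightDivisorFS_apply_inr (x : F) (v : HeightOneSpectrum (𝓞 F)) :
    heightDivisorFS x (Sum.inr v) = ((-ord F v x).toNat : ℝ) := rfl

end ADivisor

/-- `log⁺ t ≤ ½·log(1+t²) ≤ log⁺ t + ½·log 2` for `t ≥ 0`. [folklore] -/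
private theorem posLog_le_half_log_one_add_sq {t : ℝ} (ht : 0 ≤ t) :
    log⁺ t ≤ 2⁻¹ * Real.log (1 + t ^ 2) ∧
      2⁻¹ * Real.log (1 + t ^ 2) ≤ log⁺ t + 2⁻¹ * Real.log 2 := by
  have h1 : 0 < 1 + t ^ 2 := by positivity
  have hm : (0 : ℝ) < max 1 (t ^ 2) := zero_lt_one.trans_le (le_max_left _ _)
  have hmax : log⁺ t = 2⁻¹ * Real.log (max 1 (t ^ 2)) := by
    rw [posLog_eq_log_max_one ht]
    rcases le_or_gt t 1 with h | h
    · rw [max_eq_left h, max_eq_left (by nlinarith), Real.log_one, mul_zero]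
    · rw [max_eq_right h.le, max_eq_right (by nlinarith), Real.log_pow]
      push_cast
      ring
  rw [hmax]
  constructor
  · have hle : max 1 (t ^ 2) ≤ 1 + t ^ 2 := max_le (by nlinarith) (by linarith)
    exact mul_le_mul_of_nonneg_left (Real.log_le_log hm hle) (by norm_num)
  · rw [← mul_add, ← Real.log_mul hm.ne' two_ne_zero]
    have hle : 1 + t ^ 2 ≤ max 1 (t ^ 2) * 2 := by
      rcases le_or_gt (t ^ 2) 1 with h | h
      · rw [max_eq_left h]; linarith
      · rw [max_eq_right h.le]; linarith
    exact mul_le_mul_of_nonneg_left (Real.log_le_log h1 hle) (by norm_num)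

/-- **Prop. 1.4 (iii) for two metrics on `𝒪(1)`**: `0 ≤ deg_F(x_F^*𝒪̄(1)_{FS}) − deg_F(x_F^*𝒪̄(1)_{sup})
≤ [F:ℚ]·(log 2)/2`. [cite: MochizukiGenEll2010, Prop. 1.4 (iii) p.6] -/
theorem degF_heightDivisorFS_sub (x : F) :
    0 ≤ degF F (ADivisor.heightDivisorFS x) - degF F (ADivisor.heightDivisor x) ∧
      degF F (ADivisor.heightDivisorFS x) - degF F (ADivisor.heightDivisor x) ≤
        Module.finrank ℚ F * (2⁻¹ * Real.log 2) := by
  have hdiff : degF F (ADivisor.heightDivisorFS x) - degF F (ADivisor.heightDivisor x) =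
      ∑ w : InfinitePlace F, (w.mult : ℝ) * (2⁻¹ * Real.log (1 + (w x) ^ 2) - log⁺ (w x)) := by
    rw [← map_sub, degF_apply]
    have hsub : ADivisor.heightDivisorFS x - ADivisor.heightDivisor x =
        (Finsupp.equivFunOnFinite.symm fun w : InfinitePlace F =>
          (w.mult : ℝ) * (2⁻¹ * Real.log (1 + (w x) ^ 2) - log⁺ (w x))).sumElim 0 := by
      ext (w | v)
      · simp [mul_sub]
      · simp
    rw [hsub, Finsupp.sum_sumElim, Finsupp.sum_zero_index, add_zero,
      Finsupp.sum_fintype _ _ (fun _ => by simp)]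
    simp
  rw [hdiff]
  constructor
  · exact Finset.sum_nonneg fun w _ => mul_nonneg (Nat.cast_nonneg _)
      (sub_nonneg.mpr (posLog_le_half_log_one_add_sq (apply_nonneg w x)).1)
  · calc ∑ w : InfinitePlace F, (w.mult : ℝ) * (2⁻¹ * Real.log (1 + (w x) ^ 2) - log⁺ (w x))
        ≤ ∑ w : InfinitePlace F, (w.mult : ℝ) * (2⁻¹ * Real.log 2) := by
          gcongr with w
          linarith [(posLog_le_half_log_one_add_sq (apply_nonneg w x)).2]
      _ = Module.finrank ℚ F * (2⁻¹ * Real.log 2) := by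
          rw [← Finset.sum_mul, ← Nat.cast_sum, InfinitePlace.sum_mult_eq]

/-- Hence the normalised heights for the two metrics differ by at most `(log 2)/2`, uniformly in the
number field `F` — they define the same BD-class on `ℙ¹(Q̄)`. [cite: MochizukiGenEll2010, Prop. 1.4 (iii) p.6] -/
theorem abs_ndeg_heightDivisorFS_sub_le (x : F) :
    |ndeg F (ADivisor.heightDivisorFS x) - ndeg F (ADivisor.heightDivisor x)| ≤ 2⁻¹ * Real.log 2 := by
  have hd : (0 : ℝ) < Module.finrank ℚ F := by exact_mod_cast Module.finrank_pos
  obtain ⟨h0, h1⟩ := degF_heightDivisorFS_sub F x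
  rw [ndeg_apply, ndeg_apply, ← sub_div, abs_of_nonneg (div_nonneg h0 hd.le), div_le_iff₀ hd]
  linarith

end Literature.IUT.LogVolume

end
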